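import Literature.MathematicalPhysics.QuantumLattice.FinDimSpectrum
import Literature.MathematicalPhysics.QuantumLattice.LatticeTori
import Literature.MathematicalPhysics.QuantumLattice.FermionOperators
import Literature.MathematicalPhysics.QuantumLattice.HubbardModel
import Literature.MathematicalPhysics.QuantumLattice.PairCorrelations
import Literature.Probability.LatticeModels.ThermodynamicLimit
import Literature.Probability.LatticeModels.CorrelationDecay
import HarnessLib

/-!
# HubbardSuperconductivity — problem statement (D-0007: predetermined problem; this file is CREATED BY THE OPERATOR via docs/m5/create_problems.py, never proposed by agents)

Prop-valued definition (the single summit statement, D-0015), assembled by the M5 migration from: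
* `harness21/H21/H21/Statements/Hubbard/HubbardModel.lean` (1 defs)

Statement choice (D-0015 (2), expert test; no canonical printed statement exists — Arovas–Berg–
Kivelson–Raghu 2022 §1 item 1) / §9 pose the question in prose, Lieb 1995 §1 fixes the finite-volume
objects, Scalapino 1995 §2 the order functional):
* model: the PURE repulsive Hubbard model, nearest-neighbour hopping `t = 1` only (`t' = 0`),
  `H = -Σ_{⟨xy⟩,σ} c†_{xσ} c_{yσ} + U Σ_x n_{x↑} n_{x↓}` (ABKR eq. (1); Lieb §1), on the square tori
  `Λ_L = (ℤ/Lℤ)²` of EVEN side `L → ∞` (bipartite tori, Lieb §1), canonical ensemble with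
  `N_L = 2 ⌊(1 - δ) L² / 2⌋` electrons in the `S^z = 0` sector (hole doping `1 - N_L/L² → δ`);
* parameters: `∃ U > 0` (repulsive; ABKR §9, Lieb §1) and `∃ δ ∈ (0, 1/2)` (hole doping strictly
  between `0` and `1/2`; ABKR §1 "a dome of d-wave superconductivity throughout a range of doping");
* states: EVERY sequence of normalised sector ground states `ψ_L`, `L` even;
* order parameter: Scalapino's `d_{x²-y²}` PAIR-FIELD long-range order,
  `liminf_{L even} |Λ_L|⁻² ⟨ψ_L, Δ_d† Δ_d ψ_L⟩ > 0` (Scalapino 1995 §2 eq. (2.4)), i.e. the pair–pair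
  correlation with the `d`-wave form factor bounded below by some `c > 0` at large volume — NOT the
  weaker Yang ODLRO (which it implies, see the docstring).
No variant statements live in this file (D-0015 (3)).
-/

-- provenance: harness21/H21/H21/Statements/Hubbard/HubbardModel.lean @ 1052202 (interim HEAD d8f2665); M5 mechanical rewrite; audit 2026-08-13; D-0015 2026-08-13
noncomputable section

namespace Literature.Hubbard

open Matrix Finset Filter Literature.Probability.LatticeModels Literature.MathematicalPhysics.QuantumLattice
open scoped ComplexOrder Topology

/-! ### hubbard.S01: `d`-wave superconductivity in the pure 2D repulsive Hubbard model (open problem) -/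

/-- **hubbard.S01** (open problem; `d_{x²-y²}` superconductivity in the pure two-dimensional
repulsive Hubbard model; D-0015 summit statement). There exist a repulsive interaction `U > 0` and
a hole doping `δ ∈ (0, 1/2)` such that, for the pure Hubbard model
`H = -t Σ_{⟨xy⟩,σ} c†_{xσ} c_{yσ} + U Σ_x n_{x↑} n_{x↓}` with nearest-neighbour hopping `t = 1`
only (`t' = 0`; `hubbardTorus 2 L 1 U`) on the square tori `Λ_L = (ℤ/Lℤ)²` of EVEN side `L`, with
`N_L = 2 ⌊(1 - δ) L² / 2⌋` electrons (so that the hole density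
`Hubbard.doping (FermionTorus 2 L) N_L → δ`) in the `S^z = 0` sector, EVERY sequence of
normalised sector ground states `ψ_L` (`IsGroundStateInSector`, `L` even) has `d_{x²-y²}`
pair-field long-range order along even sides:
`liminf_{k → ∞} |Λ_{2k}|⁻² ⟨ψ_{2k}, Δ_d† Δ_d ψ_{2k}⟩ > 0` with
`Δ_d = Σ_x Σ_{e = ±e₁, ±e₂} g_d(e) c_{x↑} c_{x+e,↓}`, `g_d(±e₁) = 1`, `g_d(±e₂) = -1`
(`dWaveFormFactor`). As in the tree's even-torus convention (`HasStaggeredEvenTorusLRO`), the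
subsequence of even sides is taken after the pull-back to `ℤ²`: the conclusion is
`StatMech.HasLongRangeOrder` of `torusPullback (pairFieldCorr dWaveFormFactor ψ) (2k)` over the
fundamental domains `halfOpenBox 2 (2k)` (`(2k)²` sites, normalisation `|Λ|⁻² = (2k)⁻⁴`), i.e.
literally `QLattice.HasTorusLRO (pairFieldCorr dWaveFormFactor ψ)` with its `liminf` restricted to
even `L`; `QLattice.pairField` is `√2 Δ_d`, an immaterial factor `2`. The values of `ψ`, `N` at odd
`L` are unconstrained and unused. The particle-number/normalisation clause of
`QLattice.HasPairFieldLRO` is not repeated in the conclusion because it is among the hypotheses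
(`mem_szSector_iff`). Pair-field LRO implies Yang's ODLRO (largest eigenvalue of `ρ₂` of order
`N_L`, with a `B₁g`-symmetric witness, `QLattice.HasDWaveODLRO`) because
`⟨Δ_d† Δ_d⟩ = φ_d† ρ₂ φ_d` with `‖φ_d‖² = 4L²`; the converse needs an overlap hypothesis
(`QLattice.hasPairFieldLRO_dWave_of_hasODLRO`), so this is the stronger (Scalapino) form.
This is an open problem: stated as a `Prop`, not asserted.
[cite: ArovasBergKivelsonRaghu2022, §1 item 1) and §9 (§2 eq. (1) for the model)]
[cite: Lieb1995, §1] [cite: Scalapino1995, §2 eq. (2.4)] [cite: Yang1962, §4] [problem: hubbard] -/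
def DWaveSuperconductivityHubbard : Prop :=
  ∃ U : ℝ, 0 < U ∧ ∃ δ ∈ Set.Ioo (0 : ℝ) (1 / 2),
    ∀ (N : ℕ → ℕ) (ψ : ∀ L, Fock (Orb (FermionTorus 2 L))),
      (∀ L, Even L → N L = 2 * ⌊(1 - δ) * (L : ℝ) ^ 2 / 2⌋₊ ∧ star (ψ L) ⬝ᵥ ψ L = 1 ∧
          IsGroundStateInSector (hubbardTorus 2 L 1 U) (N L) 0 (ψ L)) →
        HasLongRangeOrder (fun k => halfOpenBox 2 (2 * k))
          (fun k => torusPullback (pairFieldCorr dWaveFormFactor ψ) (2 * k))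

end Literature.Hubbard

/-- The `HubbardSuperconductivity` problem statement (D-0010; canonical root-level name checked by
the gate; D-0015 single summit statement) := `Literature.Hubbard.DWaveSuperconductivityHubbard`:
`d_{x²-y²}` pair-field long-range order of every sequence of ground states of the pure
(`t = 1`, `t' = 0`) repulsive 2D Hubbard model on even square tori, for some `U > 0` and some hole
doping `δ ∈ (0, 1/2)`. [cite: ArovasBergKivelsonRaghu2022, §1 item 1) and §9] [problem: hubbard] -/
def HubbardSuperconductivity : Prop := Literature.Hubbard.DWaveSuperconductivityHubbard

/-- Unfolding: the summit is the namespaced interim statement. [folklore] -/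
theorem HubbardSuperconductivity_iff :
    HubbardSuperconductivity ↔ Literature.Hubbard.DWaveSuperconductivityHubbard :=
  Iff.rfl
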